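/-
Copyright: b2b-lace packet (CARVER gen 43, census v7, node KU-SEP).
A d-generic BOUNDED-MAJORANT reduction for the `|D̂^{(x)}|`-weighted SRW integrals `K_{n,l}(x)`,
`U_{n,l}(x)` of [NoBLE17-I] (3.36), (3.38): if `|t| ≤ B + c t² + Σ_r a_r cos(b_r t)` on `[-1,1]`, then the
atom is at most the same combination of the weight mass, the second moment of `D̂^{(x)}` and finitely many
TWISTED MOMENTS `∫ w cos(b_r D̂^{(x)}) Ĉⁿ`.  Elementary; hypothesis-free; no `sorry`; no statement at any
specific dimension; no number.
-/
import Literature.Probability.FitznerVanDerHofstad2017.SrwIntegralV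
import HarnessLib

/-!
# Bounded trigonometric majorants for `K_{n,l}(x)` and `U_{n,l}(x)` (the KU-SEP reduction)

CITATION HEADER (PLACEMENT v2). Part of the certified REPRODUCTION of the numerical inputs of
R. Fitzner, R. van der Hofstad, *Generalized approach to the non-backtracking lace expansion*,
Probab. Theory Related Fields 169 (2017) 1041–1119 [NoBLE17-I] (arXiv:1506.07969), §3.3.3 and §5.2
((3.34)–(3.38) p. 1071; (5.9), (5.14) p. 1092), as consumed by *Mean-field behavior for
nearest-neighbor percolation in `d > 10`*, Electron. J. Probab. 22 (2017) no. 43 [FvdH17].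
Origin: build `lace`, unit `b2b-lace-carver-g43` (census v7, node KU-SEP: what-if / input-certification
support lane).  Nothing here is a statement about percolation and nothing is evaluated at a specific `d`.

## What is proved, and why

[NoBLE17-I] §5.2 bounds the absolute value `|D̂^{(x)}(k)|` inside `K_{n,l}(x)` ((3.36)) and `U_{n,l}(x)`
((3.38)) by Cauchy–Schwarz ((5.9); the tree's `srwK_le_sqrt_srwI_mul_srwL`), i.e. by the quadratic
majorant `|t| ≤ (λ + λ⁻¹ t²)/2`.  The tree already records the general POLYNOMIAL majorant lever at
`x = 0` (`srwK_zero_le_of_majorant`: any `|t|^m ≤ Σ p_j t^j` on `[-1,1]` integrates, by positivity of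
`Ĉⁿ dk`, to a bound by the moments `I_{n,j}(0)`).  This module records the same one-line lever for an
arbitrary node `x`, an arbitrary bounded measurable weight `0 ≤ w ≤ W` (`w = |D̂|^l` gives `K`, `w = |D̂|^l D̂^{sin}`
gives `U`), and a majorant family that stays BOUNDED on `[-1,1]`:

  `|t| ≤ g(t) := B + c t² + Σ_{r<R} a_r cos(b_r t)`  for all `t ∈ [-1,1]`           (hypothesis `hmaj`)

  `⟹  ∫ w |D̂^{(x)}| Ĉⁿ dk/(2π)^d ≤ B·Tw^w_n(x;0) + c·Sq^w_n(x) + Σ_r a_r·Tw^w_n(x;b_r)`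
                                                   (`integral_weight_abs_DhatSym_le_of_trigMajorant`),

where `Tw^w_n(x;β) := ∫ w cos(β D̂^{(x)}) Ĉⁿ dk/(2π)^d` (`srwTwist`; at `β = 0` it is the weight mass
`∫ w Ĉⁿ`) and `Sq^w_n(x) := ∫ w (D̂^{(x)})² Ĉⁿ dk/(2π)^d` (`srwSqMom`).  The corollaries
**`srwK_le_of_trigMajorant`** and **`srwU_le_of_trigMajorant`** are the `K` / `U` instances.

Why this shape (provenance-only prose; nothing below is used in a proof).  At an axis node `x = m e_i`
one has `D̂^{(x)}(k) = D̂(m k) = d⁻¹ Σ_s cos(m k_s)` (`DhatSym_smul`, `DhatSym_single`), so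
`cos(β D̂^{(x)}(k)) = Re Π_s exp(i (β/d) cos(m k_s))` FACTORISES over the coordinates, exactly like
`cos(x·k)` in the seed integrals `I_{n,l}(x)`: the twisted moments are one-dimensional `u`-integrals of
products of Jacobi–Anger rows `Σ_j ε_j i^j c_j(β/d) e^{-u} I_{jm}(u)` and are certifiable by the tree's
seed-certificate kernel architecture (`SrwSeedCertKernelD`, Poisson block + `[T,∞)` bracket) with complex
rational rows — no quadrature of special functions is needed, which is the point of the bounded family
(an unbounded majorant such as `cosh` produces rows of size `e^{β}` that must cancel).  The coefficients
`(B, c, a_r, b_r)` are free real parameters here; an instance supplies rationals found by a linear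
programme and a kernel-checked proof of `hmaj` (a one-variable inequality on a compact interval).  In the
originating unit's float experiments (what-if, not a certificate) the family `{1, t², cos(b t) : b d ∈
{1/2, 1, …, 3}}` loses `≤ 2.2 %` against the exact value of `K_{n,l}(m e₁)`, `U_{n,l}(m e₁)` uniformly in
`n ≤ 4`, `m ≥ 1` at the SRW-table parameter, against `21–31 %` for (5.9); that comparison is prose.

## What is here
* `srwTwist`, `srwSqMom` and the integrability of their integrands for `d ≥ 2n+1`
  (`integrable_weight_cos_mul_Chat_pow`, `integrable_weight_sq_mul_Chat_pow`);
* the lever **`integral_weight_abs_DhatSym_le_of_trigMajorant`**;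
* the instances **`srwK_le_of_trigMajorant`** (`w = |D̂|^l`) and **`srwU_le_of_trigMajorant`**
  (`w = |D̂|^l D̂^{sin}`, `d ≥ 1`); any other bounded weight (e.g. `|D̂|^l M̂²`) is served by the lever
  directly.

## References
* [NoBLE17-I] R. Fitzner, R. van der Hofstad, PTRF 169 (2017) 1041–1119; arXiv:1506.07969 — (3.34)–(3.38)
  p. 1071; §5.2 (5.9), (5.14) p. 1092.
* [HS92b] T. Hara, G. Slade, *The lace expansion for self-avoiding walk in five or more dimensions*,
  Reviews in Math. Physics 4 (1992) 235–327 — App. B (B.24)–(B.27) (the Cauchy–Schwarz / majorant step).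
* [FvdH17] R. Fitzner, R. van der Hofstad, EJP 22 (2017) no. 43; arXiv:1506.07977 — consumer of the tables.
-/

noncomputable section

open MeasureTheory Real Finset
open scoped BigOperators

namespace Literature.Probability.FitznerVanDerHofstad2017

open Literature.Barriers.CriticalPhenomena
open Literature.Barriers.CriticalPhenomena.Slade2006Prop53 (P)

variable {d : ℕ}

/-! ### The twisted moment and the second moment of `D̂^{(x)}` under a weight -/

/-- The TWISTED MOMENT `Tw^w_n(x;β) = ∫_{[-π,π]^d} w(k) cos(β D̂^{(x)}(k)) Ĉ(k)ⁿ dk/(2π)^d` of the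
symmetrised exponential `D̂^{(x)}` ((3.34)) under a weight `w` (`w = |D̂|^l`: the `K`-weight of (3.36);
`w = |D̂|^l D̂^{sin}`: the `U`-weight of (3.38)); `β = 0` gives the weight mass `∫ w Ĉⁿ dk/(2π)^d`.
[cite: FitznerVanDerHofstad2016NoBLE, (3.34) p. 1071; (3.36) p. 1071] -/
def srwTwist (d n : ℕ) (w : (Fin d → ℝ) → ℝ) (x : Fin d → ℤ) (β : ℝ) : ℝ :=
  (∫ k, (w k * Real.cos (β * DhatSym d x k)) * Chat d 1 k ^ n ∂P d) / (2 * π) ^ d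

/-- The SECOND MOMENT `Sq^w_n(x) = ∫_{[-π,π]^d} w(k) D̂^{(x)}(k)² Ĉ(k)ⁿ dk/(2π)^d` of `D̂^{(x)}` ((3.34))
under a weight `w` (for `w = 1` this is `L_n(x)` of (5.7)).
[cite: FitznerVanDerHofstad2016NoBLE, (3.34) p. 1071; (5.7) p. 1091] -/
def srwSqMom (d n : ℕ) (w : (Fin d → ℝ) → ℝ) (x : Fin d → ℤ) : ℝ :=
  (∫ k, (w k * DhatSym d x k ^ 2) * Chat d 1 k ^ n ∂P d) / (2 * π) ^ d

/-- The twisted-moment integrand `w cos(β D̂^{(x)}) Ĉⁿ` is integrable for a bounded measurable weight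
`|w| ≤ W` and `d ≥ 2n + 1` (`|cos| ≤ 1` and the tree's `integrable_Chat_pow`).
[cite: HeydenreichVanDerHofstad2017, Prop. 5.5] -/
theorem integrable_weight_cos_mul_Chat_pow {n : ℕ} (hd : 2 * n + 1 ≤ d) {w : (Fin d → ℝ) → ℝ}
    (hw : Measurable w) {W : ℝ} (hw1 : ∀ k, |w k| ≤ W) (x : Fin d → ℤ) (β : ℝ) :
    Integrable (fun k => (w k * Real.cos (β * DhatSym d x k)) * Chat d 1 k ^ n) (P d) :=
  have hm : Measurable fun k => w k * Real.cos (β * DhatSym d x k) :=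
    hw.mul (Real.measurable_cos.comp (measurable_const.mul (measurable_DhatSym d x)))
  (integrable_Chat_pow n hd zero_le_one le_rfl).bdd_mul hm.aestronglyMeasurable
    (ae_of_all _ fun k => by
      rw [Real.norm_eq_abs, abs_mul]
      exact (mul_le_of_le_one_right (abs_nonneg _) (Real.abs_cos_le_one _)).trans (hw1 k))

/-- The second-moment integrand `w (D̂^{(x)})² Ĉⁿ` is integrable for a bounded measurable weight
`|w| ≤ W` and `d ≥ 2n + 1` (`|D̂^{(x)}| ≤ 1` and the tree's `integrable_Chat_pow`).
[cite: HeydenreichVanDerHofstad2017, Prop. 5.5] -/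
theorem integrable_weight_sq_mul_Chat_pow {n : ℕ} (hd : 2 * n + 1 ≤ d) {w : (Fin d → ℝ) → ℝ}
    (hw : Measurable w) {W : ℝ} (hw1 : ∀ k, |w k| ≤ W) (x : Fin d → ℤ) :
    Integrable (fun k => (w k * DhatSym d x k ^ 2) * Chat d 1 k ^ n) (P d) :=
  have hm : Measurable fun k => w k * DhatSym d x k ^ 2 := hw.mul ((measurable_DhatSym d x).pow_const 2)
  (integrable_Chat_pow n hd zero_le_one le_rfl).bdd_mul hm.aestronglyMeasurable
    (ae_of_all _ fun k => by
      rw [Real.norm_eq_abs, abs_mul, abs_pow]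
      exact (mul_le_of_le_one_right (abs_nonneg _)
        (pow_le_one₀ (abs_nonneg _) (abs_DhatSym_le_one x k))).trans (hw1 k))

/-! ### The lever -/

/-- **Bounded-majorant lever.**  Let `0 ≤ w ≤ W` be a measurable weight and `d ≥ 2n + 1`.  If
`|t| ≤ B + c t² + Σ_{r<R} a_r cos(b_r t)` for every `t ∈ [-1,1]`, then, by positivity of `w Ĉⁿ dk` and
`|D̂^{(x)}| ≤ 1`,
`∫ w |D̂^{(x)}| Ĉⁿ dk/(2π)^d ≤ B·Tw^w_n(x;0) + c·Sq^w_n(x) + Σ_r a_r·Tw^w_n(x;b_r)`.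
This is the step (5.9)/(5.14) of the source with the quadratic majorant replaced by an arbitrary bounded
trigonometric one. [cite: FitznerVanDerHofstad2016NoBLE, (5.9) p. 1092; (5.14) p. 1092] -/
theorem integral_weight_abs_DhatSym_le_of_trigMajorant {n : ℕ} (hd : 2 * n + 1 ≤ d)
    {w : (Fin d → ℝ) → ℝ} (hw : Measurable w) (hw0 : ∀ k, 0 ≤ w k) {W : ℝ} (hw1 : ∀ k, w k ≤ W)
    (x : Fin d → ℤ) {R : ℕ} (B c : ℝ) (a b : Fin R → ℝ)
    (hmaj : ∀ t ∈ Set.Icc (-1 : ℝ) 1, |t| ≤ B + c * t ^ 2 + ∑ r, a r * Real.cos (b r * t)) :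
    (∫ k, (w k * |DhatSym d x k|) * Chat d 1 k ^ n ∂P d) / (2 * π) ^ d ≤
      B * srwTwist d n w x 0 + c * srwSqMom d n w x + ∑ r, a r * srwTwist d n w x (b r) := by
  have hw1' : ∀ k, |w k| ≤ W := fun k => by rw [abs_of_nonneg (hw0 k)]; exact hw1 k
  -- integrability of the three kinds of integrands
  have hI0 : Integrable (fun k => (w k * Real.cos (0 * DhatSym d x k)) * Chat d 1 k ^ n) (P d) :=
    integrable_weight_cos_mul_Chat_pow hd hw hw1' x 0
  have hI2 : Integrable (fun k => (w k * DhatSym d x k ^ 2) * Chat d 1 k ^ n) (P d) :=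
    integrable_weight_sq_mul_Chat_pow hd hw hw1' x
  have hIr : ∀ r, Integrable (fun k => (w k * Real.cos (b r * DhatSym d x k)) * Chat d 1 k ^ n) (P d) :=
    fun r => integrable_weight_cos_mul_Chat_pow hd hw hw1' x (b r)
  have hB : Integrable (fun k => B * ((w k * Real.cos (0 * DhatSym d x k)) * Chat d 1 k ^ n)) (P d) :=
    hI0.const_mul B
  have hC : Integrable (fun k => c * ((w k * DhatSym d x k ^ 2) * Chat d 1 k ^ n)) (P d) :=
    hI2.const_mul c
  have hBC : Integrable (fun k => B * ((w k * Real.cos (0 * DhatSym d x k)) * Chat d 1 k ^ n)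
      + c * ((w k * DhatSym d x k ^ 2) * Chat d 1 k ^ n)) (P d) := hB.add hC
  have hS : Integrable (fun k => ∑ r, a r * ((w k * Real.cos (b r * DhatSym d x k)) * Chat d 1 k ^ n))
      (P d) := integrable_finsetSum _ fun r _ => (hIr r).const_mul (a r)
  have hG : Integrable (fun k => B * ((w k * Real.cos (0 * DhatSym d x k)) * Chat d 1 k ^ n)
      + c * ((w k * DhatSym d x k ^ 2) * Chat d 1 k ^ n)
      + ∑ r, a r * ((w k * Real.cos (b r * DhatSym d x k)) * Chat d 1 k ^ n)) (P d) := hBC.add hS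
  -- the right-hand side is the (normalised) integral of the combined integrand
  have hrhs : B * srwTwist d n w x 0 + c * srwSqMom d n w x + ∑ r, a r * srwTwist d n w x (b r) =
      (∫ k, (B * ((w k * Real.cos (0 * DhatSym d x k)) * Chat d 1 k ^ n)
        + c * ((w k * DhatSym d x k ^ 2) * Chat d 1 k ^ n)
        + ∑ r, a r * ((w k * Real.cos (b r * DhatSym d x k)) * Chat d 1 k ^ n)) ∂P d) / (2 * π) ^ d := by
    rw [integral_add hBC hS, integral_add hB hC, integral_const_mul, integral_const_mul,
      integral_finsetSum _ fun r _ => (hIr r).const_mul (a r)]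
    simp only [integral_const_mul, add_div, Finset.sum_div, srwTwist, srwSqMom, mul_div_assoc]
  rw [hrhs]
  refine div_le_div_of_nonneg_right ?_ (two_pi_pow_pos d).le
  refine integral_mono_of_nonneg (ae_of_all _ fun k => ?_) hG (ae_of_all _ fun k => ?_)
  · exact mul_nonneg (mul_nonneg (hw0 k) (abs_nonneg _)) (pow_nonneg (Chat_one_nonneg k) n)
  · -- pointwise: `w |t| Ĉⁿ ≤ w g(t) Ĉⁿ` with `t = D̂^{(x)}(k) ∈ [-1,1]`
    have ht : DhatSym d x k ∈ Set.Icc (-1 : ℝ) 1 := abs_le.1 (abs_DhatSym_le_one x k)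
    have hg := hmaj _ ht
    have hwC : 0 ≤ w k * Chat d 1 k ^ n := mul_nonneg (hw0 k) (pow_nonneg (Chat_one_nonneg k) n)
    show (w k * |DhatSym d x k|) * Chat d 1 k ^ n ≤
      B * ((w k * Real.cos (0 * DhatSym d x k)) * Chat d 1 k ^ n)
        + c * ((w k * DhatSym d x k ^ 2) * Chat d 1 k ^ n)
        + ∑ r, a r * ((w k * Real.cos (b r * DhatSym d x k)) * Chat d 1 k ^ n)
    have e : B * ((w k * Real.cos (0 * DhatSym d x k)) * Chat d 1 k ^ n)
        + c * ((w k * DhatSym d x k ^ 2) * Chat d 1 k ^ n)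
        + ∑ r, a r * ((w k * Real.cos (b r * DhatSym d x k)) * Chat d 1 k ^ n)
        = (B + c * DhatSym d x k ^ 2 + ∑ r, a r * Real.cos (b r * DhatSym d x k))
            * (w k * Chat d 1 k ^ n) := by
      rw [zero_mul, Real.cos_zero, mul_one, add_mul, add_mul, Finset.sum_mul]
      congr 1
      · ring
      · exact Finset.sum_congr rfl fun r _ => by ring
    rw [e]
    calc (w k * |DhatSym d x k|) * Chat d 1 k ^ n = |DhatSym d x k| * (w k * Chat d 1 k ^ n) := by ring
      _ ≤ (B + c * DhatSym d x k ^ 2 + ∑ r, a r * Real.cos (b r * DhatSym d x k))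
            * (w k * Chat d 1 k ^ n) := mul_le_mul_of_nonneg_right hg hwC

/-! ### The `K` and `U` instances -/

/-- **`K_{n,l}(x)` by a bounded majorant**: for `d ≥ 2n + 1` and `|t| ≤ B + c t² + Σ_r a_r cos(b_r t)` on
`[-1,1]`, `K_{n,l}(x) ≤ B·Tw^w_n(x;0) + c·Sq^w_n(x) + Σ_r a_r·Tw^w_n(x;b_r)` with the weight `w = |D̂|^l`
((3.36); the Cauchy–Schwarz bound (5.9) is the case `g(t) = (λ + λ⁻¹ t²)/2`).
[cite: FitznerVanDerHofstad2016NoBLE, (3.36) p. 1071; (5.9) p. 1092] -/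
theorem srwK_le_of_trigMajorant {n : ℕ} (hd : 2 * n + 1 ≤ d) (l : ℕ) (x : Fin d → ℤ) {R : ℕ}
    (B c : ℝ) (a b : Fin R → ℝ)
    (hmaj : ∀ t ∈ Set.Icc (-1 : ℝ) 1, |t| ≤ B + c * t ^ 2 + ∑ r, a r * Real.cos (b r * t)) :
    srwK d n l x ≤ B * srwTwist d n (fun k => |Dhat d k| ^ l) x 0
      + c * srwSqMom d n (fun k => |Dhat d k| ^ l) x
      + ∑ r, a r * srwTwist d n (fun k => |Dhat d k| ^ l) x (b r) := by
  rw [srwK]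
  exact integral_weight_abs_DhatSym_le_of_trigMajorant hd
    ((continuous_Dhat d).measurable.abs.pow_const l) (fun k => pow_nonneg (abs_nonneg _) l)
    (fun k => abs_Dhat_pow_le_one l k) x B c a b hmaj

/-- **`U_{n,l}(x)` by a bounded majorant**: for `d ≥ 2n + 1` and `|t| ≤ B + c t² + Σ_r a_r cos(b_r t)`
on `[-1,1]`, `U_{n,l}(x) ≤ B·Tw^w_n(x;0) + c·Sq^w_n(x) + Σ_r a_r·Tw^w_n(x;b_r)` with the weight
`w = |D̂|^l D̂^{sin}` ((3.38); `0 ≤ D̂^{sin} ≤ 1`).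
[cite: FitznerVanDerHofstad2016NoBLE, (3.38) p. 1071; (5.9) p. 1092] -/
theorem srwU_le_of_trigMajorant {n : ℕ} (hd : 2 * n + 1 ≤ d) (l : ℕ) (x : Fin d → ℤ) {R : ℕ}
    (B c : ℝ) (a b : Fin R → ℝ)
    (hmaj : ∀ t ∈ Set.Icc (-1 : ℝ) 1, |t| ≤ B + c * t ^ 2 + ∑ r, a r * Real.cos (b r * t)) :
    srwU d n l x ≤ B * srwTwist d n (fun k => |Dhat d k| ^ l * Dsin d k) x 0
      + c * srwSqMom d n (fun k => |Dhat d k| ^ l * Dsin d k) x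
      + ∑ r, a r * srwTwist d n (fun k => |Dhat d k| ^ l * Dsin d k) x (b r) := by
  have hd1 : 1 ≤ d := by omega
  have e : srwU d n l x =
      (∫ k, ((|Dhat d k| ^ l * Dsin d k) * |DhatSym d x k|) * Chat d 1 k ^ n ∂P d) / (2 * π) ^ d := by
    rw [srwU]
    congr 1
    refine integral_congr_ae (ae_of_all _ fun k => ?_)
    show (|Dhat d k| ^ l * |DhatSym d x k| * Dsin d k) * Chat d 1 k ^ n =
      ((|Dhat d k| ^ l * Dsin d k) * |DhatSym d x k|) * Chat d 1 k ^ n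
    ring
  rw [e]
  exact integral_weight_abs_DhatSym_le_of_trigMajorant hd
    (((continuous_Dhat d).measurable.abs.pow_const l).mul (continuous_Dsin d).measurable)
    (fun k => mul_nonneg (pow_nonneg (abs_nonneg _) l) (Dsin_nonneg k))
    (fun k => mul_le_one₀ (abs_Dhat_pow_le_one l k) (Dsin_nonneg k) (Dsin_le_one hd1 k)) x B c a b hmaj

end Literature.Probability.FitznerVanDerHofstad2017

end
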